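import Mathlib
import HarnessLib

/-!
# Crux `PriceOfContractivity` (stmt-ValiantsHypothesis-10583), line `registered` — stub
# `stubN_gramStein` (piece N2: the Gram matrix of the weighted model space; Stein identity)

Route `ValiantsHypothesis/ContractivityPrice`, crux K1
(`Summit.ValiantsHypothesis.ValiantsHypothesis.Theses.ContractivityPrice.PriceOfContractivity`).
Rev 17 of the lead's skeleton registers the first unconditional two-variable case of the
norm-halving stub NH₁ (profile `(n, 1)`), realised on the WEIGHTED MODEL SPACE
`W⁺ = {u/a : deg u ≤ N+1}` normed by `‖g‖² = Σ_k |ĝ(k)|² 2^k` (`ĝ` = Taylor coefficients at `0`).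
This file proves piece N2: for `a(0) = 1`, `deg a ≤ N + 1` and geometrically decaying
coefficients of the power series `a⁻¹` (`|ĥ(m)| ≤ C/2^m`), the matrix
`Gp i j = Σ_k conj(f̂ᵢ(k)) f̂ⱼ(k) 2^k` (`f̂ⱼ(k) = ĥ(k - j)` the coefficients of `ξ^j · a⁻¹`) is
Hermitian, represents the quadratic form `v ↦ Σ_k |ĝ(k)|² 2^k` for `g = (Σ vⱼ ξ^j) · a⁻¹`
(a summable series), is positive definite, and satisfies the STEIN IDENTITY
`v* Gp v = 2 (Ŝv)* G (Ŝv) + |v₀|²`, `G` the leading `(N+1) × (N+1)` block and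
`(Ŝv)_k = v_{k+1} − v₀ a_{k+1}` the coordinates of the backward shift `(g − g(0))/ξ`.

## Proof

Everything is absolutely convergent (`|f̂ᵢ(k) f̂ⱼ(k)| 2^k ≤ C² 2^{i+j} 2^{-k}`), so the two
finite sums defining `v* Gp v` commute with the series and the summand collapses to
`|ĝ(k)|² 2^k` with `ĝ(k) = Σ_j v_j f̂ⱼ(k)` (the `k`-th coefficient of `(Σ vⱼ ξ^j) · a⁻¹`).
Positivity: a vanishing quadratic form forces `ĝ ≡ 0`, i.e. `(Σ vⱼ ξ^j) · a⁻¹ = 0`, hence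
`Σ vⱼ ξ^j = 0` and `v = 0`.  Stein: `ĝ(0) = v₀` and, with `w_k = v_{k+1} − v₀ a_{k+1}`,
`X · (Σ w_k ξ^k) = (Σ vⱼ ξ^j) − v₀ · a` as polynomials, so `ĝ(k+1)` is the `k`-th coefficient of
`(Σ w_k ξ^k) · a⁻¹`; splitting off the `k = 0` term of the series gives the identity, the
remaining series being the quadratic form of the leading block at `w`.  Folklore; no cited facts.
-/

noncomputable section

-- `Summit.<Summit>.<Problem>` repeats `ValiantsHypothesis` by the tree's layout convention (D-0017).
set_option linter.dupNamespace false

namespace Summit.ValiantsHypothesis.ValiantsHypothesis.Theorems.PriceOfContractivity.NormHalvingModelSpace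

open scoped ComplexConjugate

open Finset Matrix

section Analytic

/-! ### Absolutely convergent Gram sums

Throughout this section `f : ℕ → ℕ → ℂ` is an abstract coefficient array with the geometric
decay `‖f j k‖ ≤ C 2^j / 2^k`; the Gram entries are `Σ_k conj(f i k) f j k 2^k`. -/

variable (f : ℕ → ℕ → ℂ) (C : ℝ)

/-- The geometric majorant `k ↦ B / 2^k` is summable. [folklore] -/
theorem summable_div_two_pow (B : ℝ) : Summable (fun k : ℕ => B / (2 : ℝ) ^ k) := by
  refine (summable_geometric_two.mul_left B).congr fun k => ?_
  simp [div_eq_mul_inv, inv_pow]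

/-- Each Gram series `Σ_k conj(f i k) f j k 2^k` converges absolutely. [folklore] -/
theorem summable_gramTerm (hf : ∀ j k, ‖f j k‖ ≤ C * 2 ^ j / 2 ^ k) (i j : ℕ) :
    Summable (fun k : ℕ => conj (f i k) * f j k * (2 : ℂ) ^ k) := by
  refine Summable.of_norm_bounded (summable_div_two_pow (C * 2 ^ i * (C * 2 ^ j))) fun k => ?_
  rw [norm_mul, norm_mul, Complex.norm_conj, norm_pow, Complex.norm_two]
  have h2 : (0 : ℝ) < 2 ^ k := pow_pos two_pos k
  have h1 : ‖f i k‖ * ‖f j k‖ ≤ C * 2 ^ i / 2 ^ k * (C * 2 ^ j / 2 ^ k) :=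
    mul_le_mul (hf i k) (hf j k) (norm_nonneg _) ((norm_nonneg _).trans (hf i k))
  calc ‖f i k‖ * ‖f j k‖ * 2 ^ k ≤ C * 2 ^ i / 2 ^ k * (C * 2 ^ j / 2 ^ k) * 2 ^ k :=
        mul_le_mul_of_nonneg_right h1 h2.le
    _ = C * 2 ^ i * (C * 2 ^ j) / 2 ^ k := by field_simp

/-- The Gram entries are conjugate-symmetric. [folklore] -/
theorem star_gramEntry (i j : ℕ) :
    star (∑' k : ℕ, conj (f j k) * f i k * (2 : ℂ) ^ k) =
      ∑' k : ℕ, conj (f i k) * f j k * (2 : ℂ) ^ k := by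
  rw [Complex.star_def, Complex.conj_tsum]
  refine tsum_congr fun k => ?_
  simp only [map_mul, map_pow, Complex.conj_conj, map_ofNat]
  ring

/-- The quadratic form of the Gram matrix: `Σᵢⱼ conj(uᵢ) Gpᵢⱼ uⱼ = Σ_k |Σⱼ uⱼ f j k|² 2^k`, a
summable series of nonnegative reals (Fubini for the two finite sums against the absolutely
convergent series). [folklore] -/
theorem quadForm_eq (hf : ∀ j k, ‖f j k‖ ≤ C * 2 ^ j / 2 ^ k) {n : ℕ} (u : Fin n → ℂ) :
    Summable (fun k : ℕ => ‖∑ j : Fin n, u j * f j k‖ ^ 2 * (2 : ℝ) ^ k) ∧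
    (∑ i : Fin n, conj (u i) * ∑ j : Fin n, (∑' k : ℕ, conj (f i k) * f j k * (2 : ℂ) ^ k) * u j) =
      ((∑' k : ℕ, ‖∑ j : Fin n, u j * f j k‖ ^ 2 * (2 : ℝ) ^ k : ℝ) : ℂ) := by
  have hF : ∀ i j : Fin n, Summable
      (fun k : ℕ => conj (u i) * (conj (f i k) * f j k * (2 : ℂ) ^ k * u j)) :=
    fun i j => ((summable_gramTerm f C hf i j).mul_right (u j)).mul_left (conj (u i))
  have hpt : ∀ k : ℕ,
      (∑ i : Fin n, ∑ j : Fin n, conj (u i) * (conj (f i k) * f j k * (2 : ℂ) ^ k * u j)) =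
        ((‖∑ j : Fin n, u j * f j k‖ ^ 2 * (2 : ℝ) ^ k : ℝ) : ℂ) := by
    intro k
    rw [Complex.ofReal_mul, Complex.ofReal_pow, Complex.ofReal_pow, Complex.ofReal_ofNat,
      ← Complex.conj_mul', map_sum, Finset.sum_mul, Finset.sum_mul]
    refine Finset.sum_congr rfl fun i _ => ?_
    rw [Finset.mul_sum, Finset.sum_mul]
    refine Finset.sum_congr rfl fun j _ => ?_
    rw [map_mul]
    ring
  have hsumC : Summable (fun k : ℕ =>
      ∑ i : Fin n, ∑ j : Fin n, conj (u i) * (conj (f i k) * f j k * (2 : ℂ) ^ k * u j)) :=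
    summable_sum fun i _ => summable_sum fun j _ => hF i j
  refine ⟨Complex.summable_ofReal.mp (hsumC.congr hpt), ?_⟩
  have h1 : ∀ i : Fin n, conj (u i) * ∑ j : Fin n, (∑' k : ℕ, conj (f i k) * f j k * (2 : ℂ) ^ k) * u j
      = ∑' k : ℕ, ∑ j : Fin n, conj (u i) * (conj (f i k) * f j k * (2 : ℂ) ^ k * u j) := by
    intro i
    rw [Finset.mul_sum]
    simp_rw [← tsum_mul_right, ← tsum_mul_left]
    exact (Summable.tsum_finsetSum fun j _ => hF i j).symm
  simp_rw [h1]
  rw [← Summable.tsum_finsetSum fun i _ => summable_sum fun j _ => hF i j]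
  simp_rw [hpt]
  exact (Complex.ofReal_tsum _).symm

end Analytic

section Algebra

/-! ### Coefficients of `(Σ uⱼ ξ^j) · H` -/

/-- A `Fin n`-indexed sum of a Kronecker delta against `u`. [folklore] -/
theorem sum_fin_ite_eq {n : ℕ} (u : Fin n → ℂ) (m : ℕ) :
    (∑ j : Fin n, if (j : ℕ) = m then u j else 0) = if h : m < n then u ⟨m, h⟩ else 0 := by
  split_ifs with h
  · rw [Finset.sum_eq_single ⟨m, h⟩]
    · simp
    · intro j _ hj
      rw [if_neg]
      exact fun h' => hj (Fin.ext h')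
    · simp
  · exact Finset.sum_eq_zero fun j _ => if_neg fun h' : (j : ℕ) = m => h (h' ▸ j.isLt)

/-- The coefficients of `Σⱼ uⱼ ξ^j` are the `uⱼ` (and `0` beyond `n`). [folklore] -/
theorem coeff_sum_monomial {n : ℕ} (u : Fin n → ℂ) (m : ℕ) :
    (∑ j : Fin n, Polynomial.monomial (j : ℕ) (u j)).coeff m = if h : m < n then u ⟨m, h⟩ else 0 := by
  rw [Polynomial.finsetSum_coeff, ← sum_fin_ite_eq]
  simp only [Polynomial.coeff_monomial]

/-- The `k`-th coefficient of `(Σⱼ uⱼ ξ^j) · H` is `Σⱼ uⱼ Ĥ(k - j)` (terms with `j > k` absent).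
[folklore] -/
theorem coeff_coe_sum_monomial_mul {n : ℕ} (u : Fin n → ℂ) (H : PowerSeries ℂ) (k : ℕ) :
    PowerSeries.coeff k
        (((∑ j : Fin n, Polynomial.monomial (j : ℕ) (u j) : Polynomial ℂ) : PowerSeries ℂ) * H) =
      ∑ j : Fin n, u j * (if (j : ℕ) ≤ k then PowerSeries.coeff (k - j) H else 0) := by
  rw [PowerSeries.coeff_mul]
  simp_rw [Polynomial.coeff_coe, Polynomial.finsetSum_coeff, Polynomial.coeff_monomial,
    Finset.sum_mul]
  rw [Finset.sum_comm]
  refine Finset.sum_congr rfl fun j _ => ?_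
  rw [Finset.Nat.sum_antidiagonal_eq_sum_range_succ
    (fun p q => (if (j : ℕ) = p then u j else 0) * PowerSeries.coeff q H)]
  simp_rw [ite_mul, zero_mul]
  rw [Finset.sum_ite_eq]
  simp only [Finset.mem_range, Nat.lt_succ_iff]
  split_ifs <;> simp

/-- Geometric decay of `Ĥ` gives the decay `‖f j k‖ ≤ C 2^j / 2^k` of the shifted arrays
`f j k = Ĥ(k - j)` (`0` for `j > k`). [folklore] -/
theorem norm_shiftCoeff_le (h : ℕ → ℂ) (C : ℝ) (hC : ∀ m, ‖h m‖ ≤ C / 2 ^ m) (j k : ℕ) :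
    ‖(if j ≤ k then h (k - j) else 0)‖ ≤ C * 2 ^ j / 2 ^ k := by
  have hC0 : 0 ≤ C := by
    have := hC 0
    rw [pow_zero, div_one] at this
    exact (norm_nonneg _).trans this
  split_ifs with hjk
  · calc ‖h (k - j)‖ ≤ C / 2 ^ (k - j) := hC _
      _ = C * 2 ^ j / 2 ^ k := by
        rw [pow_sub₀ _ two_ne_zero hjk]
        field_simp
  · rw [norm_zero]
    positivity

end Algebra

/-- **Piece N2 (the Gram matrix of the weighted model space; Stein identity).**  For `a(0) = 1`,
`deg a ≤ N + 1` and geometrically decaying coefficients of `a⁻¹` (`≤ C/2^m`), the Hermitian matrix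
`Gp_{ij} = Σ_k conj(f̂ᵢ(k)) f̂ⱼ(k) 2^k` (`f̂ⱼ` = coefficients of `ξ^j · a⁻¹`, `i, j ≤ N + 1`) is positive
definite, represents `v ↦ Σ_k |ĝ(k)|² 2^k` for `g = (Σ vⱼ ξ^j) · a⁻¹` (summable), and satisfies the Stein
identity `v* Gp v = 2 (Ŝv)* G (Ŝv) + |v₀|²` with `G` the leading `(N+1) × (N+1)` block and
`(Ŝv)_k = v_{k+1} − v₀ a_{k+1}` the coefficients of the backward shift `(g − g(0))/ξ`. [folklore] -/
theorem stubN_gramStein :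
    ∀ (N : ℕ) (a : Polynomial ℂ), a.coeff 0 = 1 → a.natDegree ≤ N + 1 →
      (∃ C : ℝ, ∀ m : ℕ, ‖PowerSeries.coeff m ((a : PowerSeries ℂ)⁻¹)‖ ≤ C / 2 ^ m) →
      ∃ Gp : Matrix (Fin (N + 2)) (Fin (N + 2)) ℂ, Gp.IsHermitian ∧
        (∀ v : Fin (N + 2) → ℂ, v ≠ 0 → 0 < RCLike.re (star v ⬝ᵥ (Gp *ᵥ v))) ∧
        (∀ v : Fin (N + 2) → ℂ,
          Summable (fun k : ℕ => ‖PowerSeries.coeff k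
              (((∑ j : Fin (N + 2), Polynomial.monomial (j : ℕ) (v j) : Polynomial ℂ) : PowerSeries ℂ) *
                (a : PowerSeries ℂ)⁻¹)‖ ^ 2 * 2 ^ k) ∧
          star v ⬝ᵥ (Gp *ᵥ v) = ((∑' k : ℕ, ‖PowerSeries.coeff k
              (((∑ j : Fin (N + 2), Polynomial.monomial (j : ℕ) (v j) : Polynomial ℂ) : PowerSeries ℂ) *
                (a : PowerSeries ℂ)⁻¹)‖ ^ 2 * 2 ^ k : ℝ) : ℂ)) ∧
        (∀ v : Fin (N + 2) → ℂ,
          star v ⬝ᵥ (Gp *ᵥ v) =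
            2 * (star (fun k : Fin (N + 1) => v k.succ - v 0 * a.coeff ((k : ℕ) + 1)) ⬝ᵥ
              ((Gp.submatrix Fin.castSucc Fin.castSucc) *ᵥ
                (fun k : Fin (N + 1) => v k.succ - v 0 * a.coeff ((k : ℕ) + 1)))) +
            ((‖v 0‖ ^ 2 : ℝ) : ℂ)) := by
  intro N a ha0 hdeg hdec
  obtain ⟨C, hC⟩ := hdec
  -- `H = a⁻¹`, `a · H = 1`, `Ĥ(0) = 1`.
  set H : PowerSeries ℂ := (a : PowerSeries ℂ)⁻¹ with hH
  have haH : (a : PowerSeries ℂ) * H = 1 :=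
    PowerSeries.mul_inv_cancel _ (by rw [Polynomial.constantCoeff_coe, ha0]; exact one_ne_zero)
  have hH0 : PowerSeries.coeff 0 H = 1 := by
    rw [PowerSeries.coeff_zero_eq_constantCoeff_apply, hH, PowerSeries.constantCoeff_inv,
      Polynomial.constantCoeff_coe, ha0, inv_one]
  -- the shifted coefficient arrays `f j k = Ĥ(k - j)`
  obtain ⟨f, hf_def⟩ : ∃ f : ℕ → ℕ → ℂ,
      f = fun j k => if j ≤ k then PowerSeries.coeff (k - j) H else 0 := ⟨_, rfl⟩
  have hf : ∀ j k, ‖f j k‖ ≤ C * 2 ^ j / 2 ^ k := fun j k => by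
    rw [hf_def]
    exact norm_shiftCoeff_le _ C hC j k
  have hcoeff : ∀ {n : ℕ} (u : Fin n → ℂ) (k : ℕ), PowerSeries.coeff k
      (((∑ j : Fin n, Polynomial.monomial (j : ℕ) (u j) : Polynomial ℂ) : PowerSeries ℂ) * H) =
        ∑ j : Fin n, u j * f j k := fun u k => by
    rw [hf_def]
    exact coeff_coe_sum_monomial_mul u H k
  -- the Gram matrix
  obtain ⟨Gp, hGp⟩ : ∃ Gp : Matrix (Fin (N + 2)) (Fin (N + 2)) ℂ,
      Gp = Matrix.of fun i j : Fin (N + 2) =>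
        ∑' k : ℕ, conj (f i k) * f j k * (2 : ℂ) ^ k := ⟨_, rfl⟩
  -- the quadratic form of a principal block `Gp[e, e]` (`e` preserving the exponents)
  have hquad : ∀ {n : ℕ} (e : Fin n → Fin (N + 2)) (_ : ∀ i, ((e i : Fin (N + 2)) : ℕ) = (i : ℕ))
      (u : Fin n → ℂ),
      Summable (fun k : ℕ => ‖PowerSeries.coeff k
          (((∑ j : Fin n, Polynomial.monomial (j : ℕ) (u j) : Polynomial ℂ) : PowerSeries ℂ) *
            H)‖ ^ 2 * (2 : ℝ) ^ k) ∧
      star u ⬝ᵥ ((Gp.submatrix e e) *ᵥ u) = ((∑' k : ℕ, ‖PowerSeries.coeff k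
          (((∑ j : Fin n, Polynomial.monomial (j : ℕ) (u j) : Polynomial ℂ) : PowerSeries ℂ) *
            H)‖ ^ 2 * (2 : ℝ) ^ k : ℝ) : ℂ) := by
    intro n e he u
    simp_rw [hcoeff]
    obtain ⟨hs, hq⟩ := quadForm_eq f C hf u
    refine ⟨hs, ?_⟩
    rw [← hq]
    simp only [dotProduct, Matrix.mulVec, Matrix.submatrix_apply, Pi.star_apply, Complex.star_def,
      hGp, Matrix.of_apply, he]
  have hquad_id : ∀ v : Fin (N + 2) → ℂ,
      Summable (fun k : ℕ => ‖PowerSeries.coeff k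
          (((∑ j : Fin (N + 2), Polynomial.monomial (j : ℕ) (v j) : Polynomial ℂ) : PowerSeries ℂ) *
            H)‖ ^ 2 * (2 : ℝ) ^ k) ∧
      star v ⬝ᵥ (Gp *ᵥ v) = ((∑' k : ℕ, ‖PowerSeries.coeff k
          (((∑ j : Fin (N + 2), Polynomial.monomial (j : ℕ) (v j) : Polynomial ℂ) : PowerSeries ℂ) *
            H)‖ ^ 2 * (2 : ℝ) ^ k : ℝ) : ℂ) := fun v => by
    have h := hquad id (fun _ => rfl) v
    rwa [Matrix.submatrix_id_id] at h
  refine ⟨Gp, ?_, ?_, hquad_id, ?_⟩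
  · -- Hermitian
    refine Matrix.IsHermitian.ext fun i j => ?_
    rw [hGp, Matrix.of_apply, Matrix.of_apply]
    exact star_gramEntry f i j
  · -- positive definite
    intro v hv
    obtain ⟨hs, hq⟩ := hquad_id v
    rw [hq, RCLike.re_to_complex, Complex.ofReal_re]
    by_contra hnot
    have hzero : ∀ k : ℕ, PowerSeries.coeff k
        (((∑ j : Fin (N + 2), Polynomial.monomial (j : ℕ) (v j) : Polynomial ℂ) : PowerSeries ℂ) *
          H) = 0 := by
      intro k
      by_contra hk
      exact hnot (hs.tsum_pos (fun k => by positivity) k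
        (mul_pos (pow_pos (norm_pos_iff.mpr hk) 2) (pow_pos two_pos k)))
    have hPH : (((∑ j : Fin (N + 2), Polynomial.monomial (j : ℕ) (v j) : Polynomial ℂ) :
        PowerSeries ℂ) * H) = 0 :=
      PowerSeries.ext fun k => by rw [hzero, map_zero]
    have hP : (∑ j : Fin (N + 2), Polynomial.monomial (j : ℕ) (v j) : Polynomial ℂ) = 0 := by
      have h0 : ((∑ j : Fin (N + 2), Polynomial.monomial (j : ℕ) (v j) : Polynomial ℂ) :
          PowerSeries ℂ) = 0 := by
        calc (((∑ j : Fin (N + 2), Polynomial.monomial (j : ℕ) (v j) : Polynomial ℂ)) : PowerSeries ℂ)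
            = ((∑ j : Fin (N + 2), Polynomial.monomial (j : ℕ) (v j) : Polynomial ℂ) :
                PowerSeries ℂ) * H * a := by
              rw [mul_assoc, mul_comm H, haH, mul_one]
          _ = 0 := by rw [hPH, zero_mul]
      exact Polynomial.coe_eq_zero_iff.mp h0
    apply hv
    funext j
    have hj := congrArg (fun p : Polynomial ℂ => p.coeff (j : ℕ)) hP
    simp only [coeff_sum_monomial, Polynomial.coeff_zero, j.isLt, dif_pos, Fin.eta] at hj
    exact hj
  · -- Stein identity
    intro v
    obtain ⟨hs, hq⟩ := hquad_id v
    obtain ⟨-, hq'⟩ := hquad Fin.castSucc Fin.val_castSucc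
      (fun k : Fin (N + 1) => v k.succ - v 0 * a.coeff ((k : ℕ) + 1))
    rw [hq, hq']
    -- the polynomial identity `X · P_w = P_v − v₀ · a`
    have hXP : Polynomial.X * (∑ k : Fin (N + 1), Polynomial.monomial (k : ℕ)
          (v k.succ - v 0 * a.coeff ((k : ℕ) + 1)) : Polynomial ℂ) =
        (∑ j : Fin (N + 2), Polynomial.monomial (j : ℕ) (v j) : Polynomial ℂ) -
          Polynomial.C (v 0) * a := by
      refine Polynomial.ext fun m => ?_
      rcases m with _ | m
      · rw [Polynomial.mul_coeff_zero, Polynomial.coeff_X_zero, zero_mul, Polynomial.coeff_sub,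
          Polynomial.coeff_C_mul, coeff_sum_monomial, ha0, dif_pos (Nat.succ_pos _)]
        simp
      · rw [Polynomial.coeff_X_mul, Polynomial.coeff_sub, Polynomial.coeff_C_mul, coeff_sum_monomial,
          coeff_sum_monomial]
        by_cases hm : m < N + 1
        · rw [dif_pos hm, dif_pos (by omega)]
          simp [Fin.succ_mk]
        · have hdm : a.natDegree < m + 1 := by omega
          rw [dif_neg hm, dif_neg (by omega), Polynomial.coeff_eq_zero_of_natDegree_lt hdm]
          ring
    -- its power-series form `X · (P_w H) = P_v H − v₀`
    have hps : PowerSeries.X * ((((∑ k : Fin (N + 1), Polynomial.monomial (k : ℕ)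
          (v k.succ - v 0 * a.coeff ((k : ℕ) + 1)) : Polynomial ℂ)) : PowerSeries ℂ) * H) =
        (((∑ j : Fin (N + 2), Polynomial.monomial (j : ℕ) (v j) : Polynomial ℂ)) : PowerSeries ℂ) *
          H - PowerSeries.C (v 0) := by
      have h := congrArg (fun p : Polynomial ℂ => (p : PowerSeries ℂ) * H) hXP
      simp only [Polynomial.coe_mul, Polynomial.coe_X, Polynomial.coe_sub, Polynomial.coe_C] at h
      rw [← mul_assoc, h, sub_mul, mul_assoc, haH, mul_one]
    have hshift : ∀ k : ℕ, PowerSeries.coeff (k + 1)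
        ((((∑ j : Fin (N + 2), Polynomial.monomial (j : ℕ) (v j) : Polynomial ℂ)) : PowerSeries ℂ) *
          H) = PowerSeries.coeff k ((((∑ k : Fin (N + 1), Polynomial.monomial (k : ℕ)
          (v k.succ - v 0 * a.coeff ((k : ℕ) + 1)) : Polynomial ℂ)) : PowerSeries ℂ) * H) := by
      intro k
      rw [← PowerSeries.coeff_succ_X_mul k (_ * H), hps, map_sub, PowerSeries.coeff_C,
        if_neg (Nat.succ_ne_zero k), sub_zero]
    have h0 : PowerSeries.coeff 0
        ((((∑ j : Fin (N + 2), Polynomial.monomial (j : ℕ) (v j) : Polynomial ℂ)) : PowerSeries ℂ) *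
          H) = v 0 := by
      rw [PowerSeries.coeff_zero_eq_constantCoeff_apply, map_mul,
        ← PowerSeries.coeff_zero_eq_constantCoeff_apply, ← PowerSeries.coeff_zero_eq_constantCoeff_apply,
        hH0, Polynomial.coeff_coe, coeff_sum_monomial, dif_pos (Nat.succ_pos _), mul_one]
      rfl
    rw [hs.tsum_eq_zero_add]
    simp_rw [hshift, h0, pow_succ, ← mul_assoc, pow_zero, mul_one]
    rw [tsum_mul_right]
    push_cast
    ring

end Summit.ValiantsHypothesis.ValiantsHypothesis.Theorems.PriceOfContractivity.NormHalvingModelSpace
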